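import Summits.QuantumFields.YangMills.Theorems.VirialFluxGapCentralProjectionDefs
import Mathlib.LinearAlgebra.CrossProduct
import HarnessLib

/-!
# Route `VirialFluxGap` (YangMills): the zero-mode field ACTING ON THE BLOCK DATA — `X_z·z_B = ½σ_B⟨Re q⟩_B·z_B` exactly, hence
# `X_z·|z_B|² = σ_B⟨Re q⟩_B·|z_B|² ≥ 0` (the C4 patching-sign input)

Brick (C4-input) of the central charts for ⟨stmt-QuantumFields-24141⟩ (LEAD design note №4 (d): the patching term `(X_c − X_g)·∇χ_c` keeps the good
sign of the radial term; note №1).  The central cut-off `χ_c` is a function of the block data `z_B` (✓`blockIm`, ✓`seamIm`); this file computes the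
action of the zero-mode half `X_z = Σ_{B} Σ_{v∈B} Σ_a ½σ_B z_{B,a}·∂_{(v,a)}` on the block data EXACTLY:

* §1 quaternion algebra: `Im(q·u_0) = (Re q, K, −J)`, `Im(q·u_1) = (−K, Re q, I)`, `Im(q·u_2) = (J, −I, Re q)` (`im_mul_zUnit_*`), i.e.
  `Σ_a z_a·Im(q·u_a) = Re q·z + Im q × z`; ★ `block_action_avg` — averaging over a block whose average of `Im q` IS `z`, the cross terms cancel
  (`z × z = 0`): `Σ_{v∈B}Σ_a (½σz_a)·Im_b(q_v u_a)/|B| = ½σ·⟨Re q⟩_B·z_b`;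
* §2 ★★ `hasDerivAt_blockIm` ∕ `hasDerivAt_seamIm` — the derivative of the block average `z_b` along the frame curve of a block variable `v` in
  direction `u_a` is `Im_b(q_v·u_a)/|B|` (cross components included; ✓`sum_imEntry_sliceTangent_block`);
* §3 ★★★ `zeroModeField_deriv_blockIm` ∕ `_seamIm` — `X_z·z_b = ½σ_B·⟨Re q⟩_B·z_b`, and ★★★ `zeroModeField_deriv_normSq_blockIm` ∕ `_seamIm` —
  `X_z·|z_B|² = σ_B·⟨Re q⟩_B·|z_B|²`, non-negative on the hemisphere of the chart (`zeroModeField_deriv_normSq_blockIm_nonneg`).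

(`matTop` local instance exactly as in the accepted frame files.)  HONEST FRAMING: exact first-order calculus of the zero-mode half on the block data; the generic field's action on `z` (the other half of the
patching term) and the charts themselves are NOT here; ⟨24141⟩ stays OPEN; the Yang–Mills mass gap is NOT proved; no summit is proved by a line.
THEOREMS ONLY (0 `def`, 0 `sorry`), standard axioms.  Width seat `ym-line-sfw-p2-w3` g58 (cell ym-idea-1, free hands), `--supports stmt-QuantumFields-24141`.
References: [cite: CosteEtAl1985]; [cite: arXiv220412737, §2 (2.4) (p. 10)].
-/

set_option autoImplicit false

noncomputable section

open scoped Matrix Quaternion BigOperators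
open Literature.MathematicalPhysics.QuantumFieldTheory hiding SU2
open Literature.MathematicalPhysics.QuantumLattice
open Literature.MathematicalPhysics.QuantumFieldTheory.SUNBakryEmery (matTop)

namespace Summit.QuantumFields.YangMills.Theorems.VirialFluxGap.FrameDerivative

open Summit.QuantumFields.YangMills.Theorems.FemtoTransferGap

variable {L : ℕ} [NeZero L]

open scoped Matrix.Norms.Frobenius

attribute [local instance 2000] Literature.MathematicalPhysics.QuantumFieldTheory.SUNBakryEmery.matTop

/-! ## §1 Quaternion algebra: `Σ_a z_a·Im(q·u_a) = Re q·z + Im q × z` -/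

omit [NeZero L] in
/-- `Im(q·u_0) = (Re q, Im_K q, −Im_J q)`. [folklore] -/
theorem im_mul_zUnit_zero (q : ℍ) :
    (![(q * zUnit 0).imI, (q * zUnit 0).imJ, (q * zUnit 0).imK] : Fin 3 → ℝ) = ![q.re, q.imK, -q.imJ] := by
  funext b
  fin_cases b <;> simp [zUnit]

omit [NeZero L] in
/-- `Im(q·u_1) = (−Im_K q, Re q, Im_I q)`. [folklore] -/
theorem im_mul_zUnit_one (q : ℍ) :
    (![(q * zUnit 1).imI, (q * zUnit 1).imJ, (q * zUnit 1).imK] : Fin 3 → ℝ) = ![-q.imK, q.re, q.imI] := by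
  funext b
  fin_cases b <;> simp [zUnit]

omit [NeZero L] in
/-- `Im(q·u_2) = (Im_J q, −Im_I q, Re q)`. [folklore] -/
theorem im_mul_zUnit_two (q : ℍ) :
    (![(q * zUnit 2).imI, (q * zUnit 2).imJ, (q * zUnit 2).imK] : Fin 3 → ℝ) = ![q.imJ, -q.imI, q.re] := by
  funext b
  fin_cases b <;> simp [zUnit]

omit [NeZero L] in
/-- ★ **Block action on the block average**: for a finite family of quaternions `q_i` whose average imaginary part is `z`
(`|s|·z = Σ_i Im q_i`), `Σ_{i∈s} Σ_a (½σ z_a)·Im_b(q_i·u_a)/|s| = ½σ·(Σ_i Re q_i/|s|)·z_b` — the cross terms `⟨Im q⟩ × z = z × z` vanish.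
[cite: CosteEtAl1985] -/
theorem block_action_avg {ι : Type*} (s : Finset ι) (q : ι → ℍ) (σ : ℝ) (z : Fin 3 → ℝ)
    (hz : ∀ a, (s.card : ℝ) * z a = ∑ i ∈ s, (![(q i).imI, (q i).imJ, (q i).imK] : Fin 3 → ℝ) a) (b : Fin 3) :
    ∑ i ∈ s, ∑ a : Fin 3, ((1 / 2 : ℝ) * σ * z a) *
        ((![(q i * zUnit a).imI, (q i * zUnit a).imJ, (q i * zUnit a).imK] : Fin 3 → ℝ) b / (s.card : ℝ)) =
      (1 / 2 : ℝ) * σ * ((∑ i ∈ s, (q i).re) / (s.card : ℝ)) * z b := by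
  rcases s.eq_empty_or_nonempty with hs | hs
  · subst hs; simp
  have hc : (0 : ℝ) < (s.card : ℝ) := by exact_mod_cast hs.card_pos
  have h0 := hz 0
  have h1 := hz 1
  have h2 := hz 2
  simp only [Matrix.cons_val_zero, Matrix.cons_val_one, Matrix.cons_val] at h0 h1 h2
  set c : ℝ := (s.card : ℝ) with hcdef
  set R : ℝ := ∑ i ∈ s, (q i).re with hR
  set I : ℝ := ∑ i ∈ s, (q i).imI with hI
  set J : ℝ := ∑ i ∈ s, (q i).imJ with hJ
  set K : ℝ := ∑ i ∈ s, (q i).imK with hK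
  fin_cases b <;> simp only [Fin.isValue, Fin.zero_eta, Fin.mk_one]
  · -- component 0: Σ_a z_a Im_0(q u_a) = z_0 Re q − z_1 Im_K q + z_2 Im_J q
    have hterm : ∀ i ∈ s, ∑ a : Fin 3, ((1 / 2 : ℝ) * σ * z a) *
        ((![(q i * zUnit a).imI, (q i * zUnit a).imJ, (q i * zUnit a).imK] : Fin 3 → ℝ) 0 / c) =
        ((1 / 2 : ℝ) * σ / c) * (z 0 * (q i).re - z 1 * (q i).imK + z 2 * (q i).imJ) := by
      intro i _
      rw [Fin.sum_univ_three, im_mul_zUnit_zero, im_mul_zUnit_one, im_mul_zUnit_two]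
      simp only [Matrix.cons_val_zero]
      field_simp
      ring
    rw [Finset.sum_congr rfl hterm, ← Finset.mul_sum, Finset.sum_add_distrib, Finset.sum_sub_distrib, ← Finset.mul_sum, ← Finset.mul_sum,
      ← Finset.mul_sum, ← hR, ← hK, ← hJ, ← h1, ← h2]
    field_simp
    ring
  · have hterm : ∀ i ∈ s, ∑ a : Fin 3, ((1 / 2 : ℝ) * σ * z a) *
        ((![(q i * zUnit a).imI, (q i * zUnit a).imJ, (q i * zUnit a).imK] : Fin 3 → ℝ) 1 / c) =
        ((1 / 2 : ℝ) * σ / c) * (z 0 * (q i).imK + z 1 * (q i).re - z 2 * (q i).imI) := by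
      intro i _
      rw [Fin.sum_univ_three, im_mul_zUnit_zero, im_mul_zUnit_one, im_mul_zUnit_two]
      simp only [Matrix.cons_val_one, Matrix.cons_val_zero]
      field_simp
      ring
    rw [Finset.sum_congr rfl hterm, ← Finset.mul_sum, Finset.sum_sub_distrib, Finset.sum_add_distrib, ← Finset.mul_sum, ← Finset.mul_sum,
      ← Finset.mul_sum, ← hR, ← hK, ← hI, ← h0, ← h2]
    field_simp
    ring
  · show ∑ i ∈ s, ∑ a : Fin 3, ((1 / 2 : ℝ) * σ * z a) *
        ((![(q i * zUnit a).imI, (q i * zUnit a).imJ, (q i * zUnit a).imK] : Fin 3 → ℝ) 2 / c) = (1 / 2 : ℝ) * σ * (R / c) * z 2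
    have hterm : ∀ i ∈ s, ∑ a : Fin 3, ((1 / 2 : ℝ) * σ * z a) *
        ((![(q i * zUnit a).imI, (q i * zUnit a).imJ, (q i * zUnit a).imK] : Fin 3 → ℝ) 2 / c) =
        ((1 / 2 : ℝ) * σ / c) * (-(z 0 * (q i).imJ) + z 1 * (q i).imI + z 2 * (q i).re) := by
      intro i _
      rw [Fin.sum_univ_three, im_mul_zUnit_zero, im_mul_zUnit_one, im_mul_zUnit_two]
      simp only [Matrix.cons_val]
      field_simp
    rw [Finset.sum_congr rfl hterm, ← Finset.mul_sum, Finset.sum_add_distrib, Finset.sum_add_distrib, Finset.sum_neg_distrib, ← Finset.mul_sum,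
      ← Finset.mul_sum, ← Finset.mul_sum, ← hR, ← hJ, ← hI, ← h0, ← h1]
    field_simp
    ring

omit [NeZero L] in
/-- Rearrangement `Σ_v Σ_a φ_{va}·(Σ_b z_b·g_{vab}) = Σ_b z_b·(Σ_v Σ_a φ_{va}·g_{vab})`. [folklore] -/
theorem sum_sum_mul_sum {α β γ : Type*} (s : Finset α) (t : Finset β) (u : Finset γ) (φ : α → β → ℝ) (z : γ → ℝ)
    (g : α → β → γ → ℝ) :
    ∑ v ∈ s, ∑ a ∈ t, φ v a * ∑ b ∈ u, z b * g v a b = ∑ b ∈ u, z b * ∑ v ∈ s, ∑ a ∈ t, φ v a * g v a b := by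
  calc ∑ v ∈ s, ∑ a ∈ t, φ v a * ∑ b ∈ u, z b * g v a b
      = ∑ v ∈ s, ∑ a ∈ t, ∑ b ∈ u, z b * (φ v a * g v a b) := by
        refine Finset.sum_congr rfl fun v _ => Finset.sum_congr rfl fun a _ => ?_
        rw [Finset.mul_sum]
        exact Finset.sum_congr rfl fun b _ => by ring
    _ = ∑ v ∈ s, ∑ b ∈ u, ∑ a ∈ t, z b * (φ v a * g v a b) := Finset.sum_congr rfl fun v _ => Finset.sum_comm
    _ = ∑ b ∈ u, ∑ v ∈ s, ∑ a ∈ t, z b * (φ v a * g v a b) := Finset.sum_comm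
    _ = ∑ b ∈ u, z b * ∑ v ∈ s, ∑ a ∈ t, φ v a * g v a b := by
        refine Finset.sum_congr rfl fun b _ => ?_
        rw [Finset.mul_sum]
        exact Finset.sum_congr rfl fun v _ => by rw [Finset.mul_sum]

/-! ## §2 Derivatives of the block data along frame curves (all components) -/

/-- ★★ **Derivative of a block average along the frame curve of a block variable** `(i,x) ∈ S` in direction `u_a`, component `b`:
`d/ds z_b = Im_b(q_{(i,x)}·u_a)/|S|` at the moving point. [cite: arXiv220412737, §2 (2.4) (p. 10)] -/
theorem hasDerivAt_blockIm {S : Finset (Fin (2 * L - 1 + 1) × Site 3 L)} (k a b : Fin 3) {i : Fin (2 * L - 1 + 1)} {x : Site 3 L}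
    (hS : (i, x) ∈ S) (P : (Fin (2 * L - 1 + 1) → GaugeConfig 3 L SU2) × (Site 3 L → SU2)) (t : ℝ) :
    HasDerivAt (fun s => blockIm L S k (P * sliceCurve i (x, k) (quatMatrix_zUnit_conjTranspose a) (quatMatrix_zUnit_trace a) s) b)
      ((![(su2Quat ((P * sliceCurve i (x, k) (quatMatrix_zUnit_conjTranspose a) (quatMatrix_zUnit_trace a) t).1 i (x, k)) * zUnit a).imI,
          (su2Quat ((P * sliceCurve i (x, k) (quatMatrix_zUnit_conjTranspose a) (quatMatrix_zUnit_trace a) t).1 i (x, k)) * zUnit a).imJ,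
          (su2Quat ((P * sliceCurve i (x, k) (quatMatrix_zUnit_conjTranspose a) (quatMatrix_zUnit_trace a) t).1 i (x, k)) * zUnit a).imK] :
          Fin 3 → ℝ) b / (S.card : ℝ)) t := by
  obtain ⟨ℓ, hℓ, hφ⟩ := exists_bsliceCoeff_clm (L := L) 2 S k b
  have hco : ∀ Q, blockIm L S k Q b = ℓ (ringCoord L Q) := fun Q => by
    rw [← hφ, bsliceCoeff_eq_blockIm]; ring
  have heq : (fun s => blockIm L S k (P * sliceCurve i (x, k) (quatMatrix_zUnit_conjTranspose a) (quatMatrix_zUnit_trace a) s) b) =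
      fun s => ℓ (ringCoord L (P * sliceCurve i (x, k) (quatMatrix_zUnit_conjTranspose a) (quatMatrix_zUnit_trace a) s)) :=
    funext fun s => hco _
  rw [heq]
  have h := hasDerivAt_comp_ringCoord_sliceCurve (L := L) ℓ.contDiff i (x, k) (quatMatrix_zUnit_conjTranspose a) (quatMatrix_zUnit_trace a) P t
  refine h.congr_deriv ?_
  rw [ℓ.fderiv, hℓ, sum_imEntry_sliceTangent_block hS, imEntry_coe_mul_quatMatrix]
  ring

/-- ★★ **Derivative of the seam average along the frame curve of a seam site** `x` in direction `u_a`, component `b`: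
`d/ds z₄_b = Im_b(q_x·u_a)/L³`. [cite: arXiv220412737, §2 (2.4) (p. 10)] -/
theorem hasDerivAt_seamIm (a b : Fin 3) (x : Site 3 L) (P : (Fin (2 * L - 1 + 1) → GaugeConfig 3 L SU2) × (Site 3 L → SU2)) (t : ℝ) :
    HasDerivAt (fun s => seamIm L (P * seamCurve x (quatMatrix_zUnit_conjTranspose a) (quatMatrix_zUnit_trace a) s) b)
      ((![(su2Quat ((P * seamCurve x (quatMatrix_zUnit_conjTranspose a) (quatMatrix_zUnit_trace a) t).2 x) * zUnit a).imI,
          (su2Quat ((P * seamCurve x (quatMatrix_zUnit_conjTranspose a) (quatMatrix_zUnit_trace a) t).2 x) * zUnit a).imJ,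
          (su2Quat ((P * seamCurve x (quatMatrix_zUnit_conjTranspose a) (quatMatrix_zUnit_trace a) t).2 x) * zUnit a).imK] : Fin 3 → ℝ) b /
        ((L : ℝ) ^ 3)) t := by
  obtain ⟨ℓ, hℓ, hφ⟩ := exists_zseamCoeff_clm (L := L) 2 b
  have hco : ∀ Q, seamIm L Q b = ℓ (ringCoord L Q) := fun Q => by
    rw [← hφ, zseamCoeff_eq_seamIm]; ring
  have heq : (fun s => seamIm L (P * seamCurve x (quatMatrix_zUnit_conjTranspose a) (quatMatrix_zUnit_trace a) s) b) =
      fun s => ℓ (ringCoord L (P * seamCurve x (quatMatrix_zUnit_conjTranspose a) (quatMatrix_zUnit_trace a) s)) :=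
    funext fun s => hco _
  rw [heq]
  have h := hasDerivAt_comp_ringCoord_seamCurve (L := L) ℓ.contDiff x (quatMatrix_zUnit_conjTranspose a) (quatMatrix_zUnit_trace a) P t
  refine h.congr_deriv ?_
  rw [ℓ.fderiv, hℓ, sum_imEntry_seamTangent, imEntry_coe_mul_quatMatrix]
  ring

/-! ## §3 The zero-mode field on the block data -/

/-- ★★★ **`X_z·z_b = ½σ·⟨Re q⟩_S·z_b` on a slice block**: summing coefficient × curve-derivative over the block's variables and the three
directions. [cite: CosteEtAl1985] -/
theorem zeroModeField_deriv_blockIm (σ : ℝ) (S : Finset (Fin (2 * L - 1 + 1) × Site 3 L)) (k b : Fin 3)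
    (P : (Fin (2 * L - 1 + 1) → GaugeConfig 3 L SU2) × (Site 3 L → SU2)) :
    ∑ v ∈ S, ∑ a : Fin 3, bsliceCoeff L σ S k a P *
        ((![(su2Quat (P.1 v.1 (v.2, k)) * zUnit a).imI, (su2Quat (P.1 v.1 (v.2, k)) * zUnit a).imJ,
            (su2Quat (P.1 v.1 (v.2, k)) * zUnit a).imK] : Fin 3 → ℝ) b / (S.card : ℝ)) =
      (1 / 2 : ℝ) * σ * ((∑ v ∈ S, (su2Quat (P.1 v.1 (v.2, k))).re) / (S.card : ℝ)) * blockIm L S k P b := by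
  simp only [bsliceCoeff_eq_blockIm]
  refine block_action_avg S (fun v => su2Quat (P.1 v.1 (v.2, k))) σ (blockIm L S k P) (fun a => ?_) b
  rcases S.eq_empty_or_nonempty with hS | hS
  · subst hS; simp [blockIm]
  · have hc : (S.card : ℝ) ≠ 0 := by exact_mod_cast hS.card_pos.ne'
    simp only [blockIm]
    rw [mul_div_cancel₀ _ hc]

/-- ★★★ **`X_z·z₄_b = ½σ₄·⟨Re q⟩_{seam}·z₄_b` on the seam block.** [cite: CosteEtAl1985] -/
theorem zeroModeField_deriv_seamIm (σ₄ : ℝ) (b : Fin 3) (P : (Fin (2 * L - 1 + 1) → GaugeConfig 3 L SU2) × (Site 3 L → SU2)) :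
    ∑ x : Site 3 L, ∑ a : Fin 3, zseamCoeff L σ₄ a P *
        ((![(su2Quat (P.2 x) * zUnit a).imI, (su2Quat (P.2 x) * zUnit a).imJ, (su2Quat (P.2 x) * zUnit a).imK] : Fin 3 → ℝ) b /
          ((L : ℝ) ^ 3)) =
      (1 / 2 : ℝ) * σ₄ * ((∑ x : Site 3 L, (su2Quat (P.2 x)).re) / ((L : ℝ) ^ 3)) * seamIm L P b := by
  have hsite : ((Finset.univ : Finset (Site 3 L)).card : ℝ) = (L : ℝ) ^ 3 := by
    rw [Finset.card_univ, TwoLattice.Electric.card_site]; push_cast; ring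
  have hL : (0 : ℝ) < (L : ℝ) := by exact_mod_cast NeZero.pos L
  have hL3 : ((L : ℝ) ^ 3) ≠ 0 := by positivity
  simp only [zseamCoeff_eq_seamIm]
  have h := block_action_avg (Finset.univ : Finset (Site 3 L)) (fun x => su2Quat (P.2 x)) σ₄ (seamIm L P) (fun a => by
    rw [hsite]; simp only [seamIm]; rw [mul_div_cancel₀ _ hL3]) b
  rw [hsite] at h
  exact h

/-- ★★★ **`X_z·|z_S|² = σ·⟨Re q⟩_S·|z_S|²`** (chain rule on `|z|² = Σ_b z_b²` with `zeroModeField_deriv_blockIm`). [cite: CosteEtAl1985] -/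
theorem zeroModeField_deriv_normSq_blockIm (σ : ℝ) (S : Finset (Fin (2 * L - 1 + 1) × Site 3 L)) (k : Fin 3)
    (P : (Fin (2 * L - 1 + 1) → GaugeConfig 3 L SU2) × (Site 3 L → SU2)) :
    ∑ v ∈ S, ∑ a : Fin 3, bsliceCoeff L σ S k a P *
        (∑ b : Fin 3, 2 * blockIm L S k P b *
          ((![(su2Quat (P.1 v.1 (v.2, k)) * zUnit a).imI, (su2Quat (P.1 v.1 (v.2, k)) * zUnit a).imJ,
              (su2Quat (P.1 v.1 (v.2, k)) * zUnit a).imK] : Fin 3 → ℝ) b / (S.card : ℝ))) =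
      σ * ((∑ v ∈ S, (su2Quat (P.1 v.1 (v.2, k))).re) / (S.card : ℝ)) * ∑ b : Fin 3, (blockIm L S k P b) ^ 2 := by
  have h := fun b => zeroModeField_deriv_blockIm (L := L) σ S k b P
  calc _ = ∑ b : Fin 3, (2 * blockIm L S k P b) * ∑ v ∈ S, ∑ a : Fin 3, bsliceCoeff L σ S k a P *
          ((![(su2Quat (P.1 v.1 (v.2, k)) * zUnit a).imI, (su2Quat (P.1 v.1 (v.2, k)) * zUnit a).imJ,
              (su2Quat (P.1 v.1 (v.2, k)) * zUnit a).imK] : Fin 3 → ℝ) b / (S.card : ℝ)) := sum_sum_mul_sum _ _ _ _ _ _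
    _ = _ := by
        simp only [h]
        rw [Finset.mul_sum]
        exact Finset.sum_congr rfl fun b _ => by ring

/-- ★ **Good sign on the hemisphere**: if every block variable has `σ·Re q_v ≥ 0` then `X_z·|z_S|² ≥ 0`. [cite: CosteEtAl1985] -/
theorem zeroModeField_deriv_normSq_blockIm_nonneg {σ : ℝ} (S : Finset (Fin (2 * L - 1 + 1) × Site 3 L)) (k : Fin 3)
    (P : (Fin (2 * L - 1 + 1) → GaugeConfig 3 L SU2) × (Site 3 L → SU2)) (hhem : ∀ v ∈ S, 0 ≤ σ * (su2Quat (P.1 v.1 (v.2, k))).re) :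
    0 ≤ σ * ((∑ v ∈ S, (su2Quat (P.1 v.1 (v.2, k))).re) / (S.card : ℝ)) * ∑ b : Fin 3, (blockIm L S k P b) ^ 2 := by
  have h1 : 0 ≤ σ * (∑ v ∈ S, (su2Quat (P.1 v.1 (v.2, k))).re) := by
    rw [Finset.mul_sum]; exact Finset.sum_nonneg hhem
  have h2 : 0 ≤ σ * ((∑ v ∈ S, (su2Quat (P.1 v.1 (v.2, k))).re) / (S.card : ℝ)) := by
    rw [← mul_div_assoc]; exact div_nonneg h1 (Nat.cast_nonneg _)
  exact mul_nonneg h2 (Finset.sum_nonneg fun b _ => sq_nonneg _)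

/-- ★★★ **`X_z·|z₄|² = σ₄·⟨Re q⟩_{seam}·|z₄|²` on the seam block.** [cite: CosteEtAl1985] -/
theorem zeroModeField_deriv_normSq_seamIm (σ₄ : ℝ) (P : (Fin (2 * L - 1 + 1) → GaugeConfig 3 L SU2) × (Site 3 L → SU2)) :
    ∑ x : Site 3 L, ∑ a : Fin 3, zseamCoeff L σ₄ a P *
        (∑ b : Fin 3, 2 * seamIm L P b *
          ((![(su2Quat (P.2 x) * zUnit a).imI, (su2Quat (P.2 x) * zUnit a).imJ, (su2Quat (P.2 x) * zUnit a).imK] : Fin 3 → ℝ) b /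
            ((L : ℝ) ^ 3))) =
      σ₄ * ((∑ x : Site 3 L, (su2Quat (P.2 x)).re) / ((L : ℝ) ^ 3)) * ∑ b : Fin 3, (seamIm L P b) ^ 2 := by
  have h := fun b => zeroModeField_deriv_seamIm (L := L) σ₄ b P
  calc _ = ∑ b : Fin 3, (2 * seamIm L P b) * ∑ x : Site 3 L, ∑ a : Fin 3, zseamCoeff L σ₄ a P *
          ((![(su2Quat (P.2 x) * zUnit a).imI, (su2Quat (P.2 x) * zUnit a).imJ, (su2Quat (P.2 x) * zUnit a).imK] : Fin 3 → ℝ) b /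
            ((L : ℝ) ^ 3)) := sum_sum_mul_sum _ _ _ _ _ _
    _ = _ := by
        simp only [h]
        rw [Finset.mul_sum]
        exact Finset.sum_congr rfl fun b _ => by ring

end Summit.QuantumFields.YangMills.Theorems.VirialFluxGap.FrameDerivative

end
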